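/-
Origin: expansion seat `planner-pub-hodgecm-pv09-g3-0`, handover #5 2026-08-18T05:41:27Z (`HOME/pub-hodgecm-pv09-g3/lean/Pv09g3/SeamIPlaces.lean`, md5 45564ee2, 103 lines);
landed by the gen-6 packager in gate run 23 as `HodgeCM/PerL34/SeamIPlaces.lean` (import ^import Pv[0-9]+g[0-9]+\.→import HodgeCM.PerL34. ×2).
-/
/-
Copyright: HodgeCM publication cell (pub-hodgecm), DAG node N31, seam (I) (prover pv09, generation 3).
Released under the package licence.

# N31 seam (I), summary file: the `rallis` field / `hEuler` binder FROM THE PLACES — every analytic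
# binder of pv11's seam theorem replaced by its honest per-place / representation-side remainder

Source under adjudication (NOT cited as a fact): PerL v5, Lemma 4.2(b), proof, tex ll. 608–612
and 628–631 (quoted verbatim in `PureTensorChar`, `PureTensorPieces`, `EulerBound`).

This file only COMPOSES the four files of this seat (`PureTensorChar`, `PureTensorCoeff`,
`PureTensorPieces`, `EulerBound`): in pv11's `AdelicFactorisation.rallis_field_of_pureTensor`
(binders `hf`, `hfm`, `hfl`, `hB`, `hI`) —
* `hf`  ↦ `hK` + `hM` (`PureTensorCoeff.IsCoordinate.isPureTensor_coeff`, `PureTensorChar`);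
* `hB`  ↦ `‖φ‖ = 1`, the non-split volume bound, the split `L¹` bound, `summable_t`
          (`EulerBound.hB_of_places`);
* `hI`  ↦ NOTHING: the local values are the real numbers `(localIntegrand … i).I` of the canonical
          local integrands, real by pv13's kernel `LocalIntegrand.integral_real`
          (`PureTensorPieces.localIntegral_real`);
* `hfm`, `hfl` stay (continuity / local integrability; `PureTensorCoeff.hEuler_of_fixedVector_of_continuous`
  and `EulerBound.integrable_localCoeff_of_isFiniteMeasure` discharge them where they are formal).

So `rallis_field_of_places` states: N31e (pv09 `RallisIP.N31e_statement`, PRODUCED as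
`N31e_holds`) + the Petersson identity `hnorm` (pv05) + `hK`, `hM` + measurability + local
integrability + the per-place volume / `L¹` facts + `summable_t` ⇒
`re ⟪θ, θ⟫ = c · vol · ∏' i, I_i` with `I_i := (localIntegrand B D ω φ χ′ i).I` — the type of pv13's
`LocalFactorDatum.rallis` with its `I` field CANONICAL.  Nothing cited; axioms = the standard trio.
Imports: this seat's `PureTensorPieces` and `EulerBound` only.  Unit `pub-hodgecm-pv09-g3`, 2026-08-18.
-/
import Summits.HodgeConjecture.HodgeCM.PerL34.PureTensorPieces
import Summits.HodgeConjecture.HodgeCM.PerL34.EulerBound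

/-! PORT of `HodgeCM/PerL34/SeamIPlaces.lean` (HodgeCMPerL run 82) — verbatim mechanical port; provenance in the PORT header line. -/

set_option autoImplicit false

noncomputable section

open MeasureTheory Set Filter Function Topology Complex ComplexConjugate

open scoped RestrictedProduct InnerProductSpace

namespace HodgeCM.PerL34.PureTensor

open HodgeCM.PerL34.AdelicFactorisation HodgeCM.PerL34.RestrictedMeasure
  HodgeCM.PerL34.NoSmallSubgroups HodgeCM.PerL34.EulerFactorisation

variable {ι : Type} {G : ι → Type} [∀ i, CommGroup (G i)] [∀ i, MeasurableSpace (G i)]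
  [∀ i, TopologicalSpace (G i)] [∀ i, OpensMeasurableSpace (G i)] [∀ i, MeasurableInv (G i)]
  {Sub : ι → Type*} [∀ i, SetLike (Sub i) (G i)] [∀ i, SubgroupClass (Sub i) (G i)]
  (B : ∀ i, Sub i) [Countable ι] [DecidableEq ι]
  {Sp : Type} [NormedAddCommGroup Sp] [InnerProductSpace ℂ Sp]
  {E : Type*} [NormedAddCommGroup E] [InnerProductSpace ℂ E]

/-- **`hEuler` from the places**: `∫ ⟪φ, ω y φ⟫ χ′(y) dμ = ∏' i, I_i` with the CANONICAL real local
factors `I_i = (localIntegrand B D ω φ χ′ i).I`, from `hK`, `hM`, continuity of `χ′`, measurability,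
local integrability, and the per-place facts feeding `hB_of_places`. -/
theorem hEuler_of_places (hBopen : ∀ i, IsOpen (B i : Set (G i)))
    (D : RestrictedProductMeasureDatum ι G (Πʳ j, [G j, B j])) [∀ i, (D.ν i).IsInvInvariant]
    (hD : IsCoordinate D) (ω : (Πʳ j, [G j, B j]) →* (Sp ≃ₗᵢ[ℂ] Sp)) (φ : Sp) (hφ : ‖φ‖ = 1)
    (χ : (Πʳ j, [G j, B j]) →* Circle) (hχ : Continuous χ) {T : Finset ι}
    (hK : ∀ k ∈ RestrictedProduct.boxSubgroup B T, ω k φ = φ)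
    (hM : ∀ S : Finset ι, T ⊆ S → ∀ y : (i : ↥S) → G i,
      inner ℂ φ (ω (extendOne B S y) φ) = ∏ i : ↥S, localCoeff B ω φ i (y i))
    (hfm : AEStronglyMeasurable (fun y => inner ℂ φ (ω y φ) * ((χ y : Circle) : ℂ)) D.μ)
    (hcl : ∀ i, Integrable (localCoeff B ω φ i) (D.ν i))
    (S₁ : Finset ι) (IsSplit : ι → Prop) (q : ι → ℕ)
    (hns : ∀ i, i ∉ S₁ → ¬IsSplit i → D.ν i Set.univ ≤ 1)
    (hsp : ∀ i, i ∉ S₁ → IsSplit i →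
      ∫ g, ‖localCoeff B ω φ i g‖ ∂D.ν i ≤ 1 + 4 * EulerProduct.tOf (q i))
    (hsum : Summable fun i : {j : ι // j ∉ S₁} => EulerProduct.tOf (q i.1)) :
    ∫ y, ⟪φ, ω y φ⟫_ℂ * ((χ y : Circle) : ℂ) ∂D.μ =
      ((∏' i, (localIntegrand B D ω φ χ i).I : ℝ) : ℂ) :=
  hEuler_of_fixedVector B hBopen D hD ω φ χ hχ hK hM hfm hcl
    (hB_of_places B D ω φ hφ T S₁ IsSplit q hns hsp hsum) (localIntegral_real B D ω φ χ)

/-- **The `rallis` field from the places** (pv13 `LocalFactorDatum.rallis` shape with CANONICAL `I`):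
N31e (pv09, PRODUCED) + the Petersson-norm identity (pv05) + `hK`, `hM`, measurability, local
integrability, the per-place volume / `L¹` facts and `summable_t` ⇒ `re ⟪θ, θ⟫ = c · vol · ∏' i, I_i`. -/
theorem rallis_field_of_places (hBopen : ∀ i, IsOpen (B i : Set (G i)))
    (D : RestrictedProductMeasureDatum ι G (Πʳ j, [G j, B j])) [∀ i, (D.ν i).IsInvInvariant]
    (hD : IsCoordinate D) (ω : (Πʳ j, [G j, B j]) →* (Sp ≃ₗᵢ[ℂ] Sp)) (φ : Sp) (hφ : ‖φ‖ = 1)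
    (χ : (Πʳ j, [G j, B j]) →* Circle) (hχ : Continuous χ) {𝓕 : Set (Πʳ j, [G j, B j])}
    {K : (Πʳ j, [G j, B j]) → (Πʳ j, [G j, B j]) → ℂ} {c vol : ℝ} {θ : E}
    (hvol : vol = (D.μ 𝓕).toReal)
    (hN31e : RallisIP.N31e_statement D.μ 𝓕 ω φ (fun y => ((χ y : Circle) : ℂ)) K (c : ℂ))
    (hnorm : ⟪θ, θ⟫_ℂ = ∫ u in 𝓕, ∫ u' in 𝓕, ((χ u : Circle) : ℂ) * conj ((χ u' : Circle) : ℂ) *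
      K u u' ∂D.μ ∂D.μ)
    {T : Finset ι} (hK : ∀ k ∈ RestrictedProduct.boxSubgroup B T, ω k φ = φ)
    (hM : ∀ S : Finset ι, T ⊆ S → ∀ y : (i : ↥S) → G i,
      inner ℂ φ (ω (extendOne B S y) φ) = ∏ i : ↥S, localCoeff B ω φ i (y i))
    (hfm : AEStronglyMeasurable (fun y => inner ℂ φ (ω y φ) * ((χ y : Circle) : ℂ)) D.μ)
    (hcl : ∀ i, Integrable (localCoeff B ω φ i) (D.ν i))
    (S₁ : Finset ι) (IsSplit : ι → Prop) (q : ι → ℕ)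
    (hns : ∀ i, i ∉ S₁ → ¬IsSplit i → D.ν i Set.univ ≤ 1)
    (hsp : ∀ i, i ∉ S₁ → IsSplit i →
      ∫ g, ‖localCoeff B ω φ i g‖ ∂D.ν i ≤ 1 + 4 * EulerProduct.tOf (q i))
    (hsum : Summable fun i : {j : ι // j ∉ S₁} => EulerProduct.tOf (q i.1)) :
    RCLike.re ⟪θ, θ⟫_ℂ = c * vol * ∏' i, (localIntegrand B D ω φ χ i).I :=
  rallis_field_of_fixedVector B hBopen D hD ω φ χ hχ hvol hN31e hnorm hK hM hfm hcl
    (hB_of_places B D ω φ hφ T S₁ IsSplit q hns hsp hsum) (localIntegral_real B D ω φ χ)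

end HodgeCM.PerL34.PureTensor

end
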